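import Summits.MatrixMultiplication.MatrixMultiplication.Theorems.OutsiderSandwichRefinedCapacity
import Summits.MatrixMultiplication.MatrixMultiplication.Theorems.OutsiderSandwichZeroSlack
import HarnessLib

/-!
# The sub-core certificate `(N, B) = (3, 2)` must be incoherent: `r_coh(3) = 3`

Route `OutsiderSandwich` (decomposition cell `decomp-mm`, lens 4 «minimal counterexample /
extremal reduction», gen 28, kernel 4), support for the aside leaf `BlockOneIsMM`
(stmt-MatrixMultiplication-27147, `θ⋆ = 0`); cut of record untouched; theorem-only.

## Content

The census's minimal open rung below the symmetric core is `(N, B) = (3, 2)`: restrict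
`⟨2,2,2⟩^{⊗3} = ⟨8,8,8⟩` to two helped copies (core value `⌈(4/3)^3⌉ = 3`; numerically `r(3) = 3`,
I75–I80).  The general coherent bounds do not reach it (`OutsiderSandwichCoherentProfile`:
coherent `⟹ |ι| ≥ 2` at `N = 3`).  The extremal analysis of this file closes the coherent case
exactly at the minimal rung:

* `no_coherent_three_two` — there is NO coherent two-copy certificate at `N = 3`.  Proof: by zero
  slack rigidity (`OutsiderSandwichZeroSlack.card_lt_of_card_lt`) the two copies wire
  `k₁ + k₂ ≥ 9` blocks; by the refined capacity law each copy has a level `jᵢ ≤ 3` with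
  `kᵢ ≤ 2^{jᵢ}`, `rank Aᵢ ≤ 3^{jᵢ} 4^{3-jᵢ} ∈ {64, 48, 36, 27}`; the subset constraints
  (`OutsiderSandwichCoherentSharing.four_pow_le_sum_finrank_add` at `S = {1}, {2}, {1,2}`) read
  `64 ≤ rank A₁ + 8 k₂`, `64 ≤ rank A₂ + 8 k₁`, `64 ≤ rank A₁ + rank A₂` — and the sixteen level
  pairs are all infeasible (`k ≥ 5` forces level `3`, rank `≤ 27`, then the partner needs rank
  `≥ 37`, level `≤ 1`, `k ≤ 2`, and `27 + 16 < 64`).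
* `three_le_card_of_coherent` — so coherent certificates at `N = 3` need `3` copies: the coherent
  exchange number at `N = 3` EQUALS the core value, `r_coh(3) = 3 = ⌈(4/3)^3⌉`.
* `exists_incoherent_copy_three_two` — contrapositively, a `(3, 2)` certificate (if any exists) has a
  copy wiring two blocks `c ≠ c'` with `τ_{c+c'} ∘ A_i ∉ K · A_i` (an INCOHERENT copy), besides
  `≥ 9` wired blocks with cancelling outputs (`OutsiderSandwichZeroSlack.subcore_three_two_slack`).

This pins the structure of the minimal conceivable counterexample to "coherent families are
optimal at small `N`" and tells the census (I76/I77/I80) where NOT to look: antisymmetric /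
symmetric-seed pencils whose two copies are each internally sign-coherent cannot reach `(3, 2)`.

## References

* M. Bläser, *Fast Matrix Multiplication*, Theory of Computing Graduate Surveys 5 (2013), §5–6.
  [Blaser2013]
* J. M. Landsberg, *Geometry and Complexity Theory*, Cambridge Studies in Advanced Mathematics 169
  (2017), §2.1, §5 (restrictions and degenerations of `M_{⟨n⟩}`; border rank lower-bound
  techniques by flattenings). [Landsberg2017]
-/

noncomputable section

open scoped BigOperators Matrix

set_option linter.dupNamespace false
set_option autoImplicit false

namespace Summit.MatrixMultiplication.MatrixMultiplication.Theorems.OutsiderSandwichSubcoreThreeTwo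

open Summit.MatrixMultiplication.MatrixMultiplication.Theorems.OutsiderSandwichTwistGluing
  Summit.MatrixMultiplication.MatrixMultiplication.Theorems.OutsiderSandwichTwistCapacity
  Summit.MatrixMultiplication.MatrixMultiplication.Theorems.OutsiderSandwichCoherentSharing
  Summit.MatrixMultiplication.MatrixMultiplication.Theorems.OutsiderSandwichRefinedCapacity
  Summit.MatrixMultiplication.MatrixMultiplication.Theorems.OutsiderSandwichZeroSlack

universe u v

variable {K : Type u} [Field K] {ι : Type v} [DecidableEq ι]

/-- The refined rank profile of one copy of a coherent wiring (any `N`): a level `j ≤ N` with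
`#(wired blocks) ≤ 2^j` and `rank A_i ≤ 3^j · 4^{N-j}`. -/
theorem copy_profile {N : ℕ}
    (A : ι → Matrix (Idx N) (Idx N) K →ₗ[K] Matrix (Idx N) (Idx N) K) (T : Finset (ι × Idx N))
    (hRel : ∀ i c c', (i, c) ∈ T → (i, c') ∈ T →
      ∃ ε : K, ∀ X, ptrans (c + c') (A i X) = ε • A i X) (i : ι) :
    ∃ j, j ≤ N ∧ (T.filter fun b : ι × Idx N => b.1 = i).card ≤ 2 ^ j ∧
      Module.finrank K (LinearMap.range (A i)) ≤ 3 ^ j * 4 ^ (N - j) := by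
  classical
  have hC : ((T.filter fun b : ι × Idx N => b.1 = i).image Prod.snd).card =
      (T.filter fun b : ι × Idx N => b.1 = i).card :=
    Finset.card_image_of_injOn fun b₁ h₁ b₂ h₂ h => by
      simp only [Finset.coe_filter, Set.mem_setOf_eq] at h₁ h₂
      exact Prod.ext (h₁.2.trans h₂.2.symm) h
  have hmem : ∀ c ∈ (T.filter fun b : ι × Idx N => b.1 = i).image Prod.snd, (i, c) ∈ T := by
    intro c hc
    obtain ⟨⟨i', c'⟩, hb, rfl⟩ := Finset.mem_image.1 hc
    obtain ⟨hT, rfl⟩ := Finset.mem_filter.1 hb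
    exact hT
  obtain ⟨j, hjN, hjk, hje⟩ := exists_rank_profile_range_of_relative (A i) _
    fun c hc c' hc' => hRel i c c' (hmem c hc) (hmem c' hc')
  exact ⟨j, hjN, hC ▸ hjk, hje⟩

/-- **No coherent certificate at `(N, B) = (3, 2)`.** -/
theorem no_coherent_three_two [Fintype ι] (hι : Fintype.card ι = 2)
    (A : ι → Matrix (Idx 3) (Idx 3) K →ₗ[K] Matrix (Idx 3) (Idx 3) K) (T : Finset (ι × Idx 3))
    (L : ι → Idx 3 → (Matrix (Idx 3) (Idx 3) K →ₗ[K] (Idx 3 → K)))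
    (R : ι → Idx 3 → ((Idx 3 → K) →ₗ[K] Matrix (Idx 3) (Idx 3) K))
    (ident : ∀ X Y : Matrix (Idx 3) (Idx 3) K,
      ∑ b ∈ T, R b.1 b.2 (Matrix.mulVec (ptrans b.2 (A b.1 X)) (L b.1 b.2 Y)) = X * Y)
    (hRel : ∀ i c c', (i, c) ∈ T → (i, c') ∈ T →
      ∃ ε : K, ∀ X, ptrans (c + c') (A i X) = ε • A i X) : False := by
  classical
  -- the two copies
  obtain ⟨i₁, i₂, hne, huniv⟩ : ∃ a b : ι, a ≠ b ∧ (Finset.univ : Finset ι) = {a, b} :=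
    Finset.card_eq_two.1 (by rw [Finset.card_univ, hι])
  have hcov : ∀ i : ι, i = i₁ ∨ i = i₂ := fun i => by
    have h := Finset.mem_univ i
    rw [huniv, Finset.mem_insert, Finset.mem_singleton] at h
    exact h
  -- zero slack rigidity: at least `9` wired blocks
  have hslack : 8 < (T.filter fun b : ι × Idx 3 => b.1 = i₁).card +
      (T.filter fun b : ι × Idx 3 => b.1 = i₂).card := by
    have h := card_lt_of_card_lt A T L R ident (by rw [hι]; norm_num)
    have hT : T.card = ∑ i ∈ (Finset.univ : Finset ι),
        (T.filter fun b : ι × Idx 3 => b.1 = i).card :=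
      Finset.card_eq_sum_card_fiberwise fun b _ => Finset.mem_univ b.1
    rw [hT, huniv, Finset.sum_pair hne] at h
    norm_num at h
    exact h
  -- subset constraints
  have hS : ∀ a b : ι, a ≠ b → (∀ i : ι, i = a ∨ i = b) →
      64 ≤ Module.finrank K (LinearMap.range (A a)) +
        8 * (T.filter fun x : ι × Idx 3 => x.1 = b).card := by
    intro a b hab hc
    have h := four_pow_le_sum_finrank_add A T L R ident {a}
    have hf : (T.filter fun x : ι × Idx 3 => x.1 ∉ ({a} : Finset ι)) =
        T.filter fun x : ι × Idx 3 => x.1 = b :=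
      Finset.filter_congr fun x _ => by
        rw [Finset.mem_singleton]
        exact ⟨fun h => (hc x.1).resolve_left h, fun h h' => hab (h'.symm.trans h)⟩
    rw [Finset.sum_singleton, hf] at h
    norm_num at h
    exact h
  have huniv' : 64 ≤ Module.finrank K (LinearMap.range (A i₁)) +
      Module.finrank K (LinearMap.range (A i₂)) := by
    have h := four_pow_le_sum_finrank_add A T L R ident Finset.univ
    have h0 : (T.filter fun x : ι × Idx 3 => x.1 ∉ (Finset.univ : Finset ι)).card = 0 :=
      Finset.card_eq_zero.2 (Finset.filter_eq_empty_iff.2 fun x _ h => h (Finset.mem_univ _))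
    rw [h0, mul_zero, add_zero, huniv, Finset.sum_pair hne] at h
    norm_num at h
    exact h
  have c1 := hS i₁ i₂ hne hcov
  have c2 := hS i₂ i₁ hne.symm fun i => (hcov i).symm
  -- levels of the two copies, and the sixteen infeasible cases
  obtain ⟨j₁, hj₁, hk₁, he₁⟩ := copy_profile A T hRel i₁
  obtain ⟨j₂, hj₂, hk₂, he₂⟩ := copy_profile A T hRel i₂
  interval_cases j₁ <;> interval_cases j₂ <;> norm_num at hk₁ he₁ hk₂ he₂ <;> omega

/-- **`r_coh(3) = 3`**: a coherent certificate at `N = 3` has at least `3 = ⌈(4/3)^3⌉` copies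
(and `3` are attained by the symmetric core, census I75). -/
theorem three_le_card_of_coherent [Fintype ι]
    (A : ι → Matrix (Idx 3) (Idx 3) K →ₗ[K] Matrix (Idx 3) (Idx 3) K) (T : Finset (ι × Idx 3))
    (L : ι → Idx 3 → (Matrix (Idx 3) (Idx 3) K →ₗ[K] (Idx 3 → K)))
    (R : ι → Idx 3 → ((Idx 3 → K) →ₗ[K] Matrix (Idx 3) (Idx 3) K))
    (ident : ∀ X Y : Matrix (Idx 3) (Idx 3) K,
      ∑ b ∈ T, R b.1 b.2 (Matrix.mulVec (ptrans b.2 (A b.1 X)) (L b.1 b.2 Y)) = X * Y)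
    (hRel : ∀ i c c', (i, c) ∈ T → (i, c') ∈ T →
      ∃ ε : K, ∀ X, ptrans (c + c') (A i X) = ε • A i X) : 3 ≤ Fintype.card ι := by
  by_contra hlt
  have hsq := four_pow_le_sq_card_mul_three_pow A T L R ident hRel
  obtain h | h | h : Fintype.card ι = 0 ∨ Fintype.card ι = 1 ∨ Fintype.card ι = 2 := by omega
  · rw [h] at hsq; norm_num at hsq
  · rw [h] at hsq; norm_num at hsq
  · exact no_coherent_three_two h A T L R ident hRel

/-- **A `(3, 2)` certificate has an incoherent copy**: some copy wires two blocks `c, c'` whose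
relative partial transpose `τ_{c+c'}` does not act on the copy's `x`-leg by a scalar. -/
theorem exists_incoherent_copy_three_two [Fintype ι] (hι : Fintype.card ι = 2)
    (A : ι → Matrix (Idx 3) (Idx 3) K →ₗ[K] Matrix (Idx 3) (Idx 3) K) (T : Finset (ι × Idx 3))
    (L : ι → Idx 3 → (Matrix (Idx 3) (Idx 3) K →ₗ[K] (Idx 3 → K)))
    (R : ι → Idx 3 → ((Idx 3 → K) →ₗ[K] Matrix (Idx 3) (Idx 3) K))
    (ident : ∀ X Y : Matrix (Idx 3) (Idx 3) K,
      ∑ b ∈ T, R b.1 b.2 (Matrix.mulVec (ptrans b.2 (A b.1 X)) (L b.1 b.2 Y)) = X * Y) :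
    ∃ i c c', (i, c) ∈ T ∧ (i, c') ∈ T ∧ c ≠ c' ∧
      ∀ ε : K, ∃ X, ptrans (c + c') (A i X) ≠ ε • A i X := by
  by_contra h
  simp only [not_exists, not_and, not_forall, not_not] at h
  refine no_coherent_three_two hι A T L R ident fun i c c' hc hc' => ?_
  by_cases hcc : c = c'
  · subst hcc
    refine ⟨1, fun X => ?_⟩
    have h0 : c + c = 0 := funext fun k => by
      have h2 : ∀ x : Fin 2, x + x = 0 := by decide
      exact h2 (c k)
    rw [h0, ptrans_zero, one_smul]
  · exact h i c c' hc hc' hcc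

end Summit.MatrixMultiplication.MatrixMultiplication.Theorems.OutsiderSandwichSubcoreThreeTwo
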